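import Summits.MatrixMultiplication.MatrixMultiplication.Theorems.ObstructionDescentKernelPolarisation
import Summits.MatrixMultiplication.MatrixMultiplication.Theorems.ObstructionDescentBlowUpDuality
import Summits.MatrixMultiplication.MatrixMultiplication.Theorems.ObstructionDescentUniversalOccurrenceTwoRectangleDetInvariants
import Summits.MatrixMultiplication.MatrixMultiplication.Theorems.ObstructionDescentUniversalOccurrenceShortLeg

set_option linter.dupNamespace false
set_option autoImplicit false

/-!
# Obstruction descent — the UPPER DIRECTION of the blow-up duality: a pairing kernel whose functional is a
# `det^δ ⊗ det^δ` semi-invariant detects the two-rectangular types `((δ^N),(δ^N),ν)`; the blow-up kernel `K_X`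
# (decomp-mm · lens 3 · gen 47, part 2; def-free)

`route-MatrixMultiplication-ObstructionDescent`, SUPPORT for the crux `NoOccurrenceObstruction` (`P_O`, stmt 29040) and the
lifting crux `OccurrenceLifts` (29042); NODE-g47 §3, critic ruling lens-3 g47 (i)(a) «the (T)-upper direction as a def-free
theorem about `isotypicSum` of an evaluation functional» and (i)(b) «inheritance in the format».

THE THEOREM (`isotypicSum₁₂₃_kroneckerPow_ne_zero_of_pairing_isotypicSum₃_ne_zero`, §7).  `n = Nδ`; `K` ANY kernel whose
functional `t ↦ ⟪t^{⊗n}, K⟫` is a semi-invariant of weight `det^δ` in legs 1 and 2 (for all matrices, all `t`).  If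
`⟪isotypicSum₃ ν (t^{⊗n}), K⟫ ≠ 0` then `((δ^N),(δ^N),ν)` OCCURS in `t^{⊗n}`:
`isotypicSum₁ (δ^N) (isotypicSum₂ (δ^N) (isotypicSum₃ ν (t^{⊗n}))) ≠ 0`.
THE BLOW-UP KERNEL (§8).  For `K = K_X`, the evaluation kernel of `D_X(t) = det(Σ_l X_l ⊗ t_{••l}) = ⟪t^{⊗Nδ}, K_X⟫`
(`blowUp_det_eq_pairing_evalKernel`), semi-invariance is K25 (`det_sum_kronecker_slice_actTensor₁₂`), and the transfer
identity `letterIsotypic_eq_pairing_isotypicSum₃_evalKernel` turns the hypothesis into «the letter-`ν` part of `D_X(t)`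
(the `ν`-isotypic sum over the `Nδ` letters of `X`, paired with `t`) is non-zero».  COROLLARIES: that non-vanishing forces
`((δ^N),(δ^N),ν) ∈ S(t)` (`occurs_twoRectangle_of_letterIsotypic_ne_zero` — the UPPER direction of NODE-g45 (T); the
lower direction «occurrence ⟹ some `X` detects» is the two-rectangle floor law) and, by inheritance along degenerations
(`occurs_unitTensor_of_algBorderRank_le`), `((δ^N),(δ^N),ν) ∈ S(⟨m⟩)` in any format `m ≥ max(N, bR(t))`
(`occurs_unitTensor_twoRectangle_of_letterIsotypic_ne_zero`) — the mechanism by which matrix multiplication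
(`D_X(⟨n,n,n⟩) = det(X)^n ≠ 0` for an invertible slot matrix, `…MatMulBlowUp`) feeds two-rectangular types to `S(⟨m⟩)`.

PROOF of §7.  With part 1: the symmetrisation `Kˢ` has `(δ^N)`-highest-weight slices in legs 1, 2; §4 on such slices the
character sum `Σ_π χ_{(δ^N)}(π) π` acts as the non-zero scalar `c = n!/χ(1)` (`HW_λ ≅ S^λ` is `χ^λ`-isotypic:
`sum_spechtCharacter_smul_wordPerm_eq_isotypicProj`, `isotypicProj_apply_of_mem_highestWeightSpace`); §5 the character sums
are self-adjoint for the pairing; §6 `T = isotypicSum₃ ν (t^{⊗n})` is diagonally symmetric, so `⟪T, Kˢ⟫ = n!·⟪T, K⟫`; hence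
`⟪isotypicSum₁ (isotypicSum₂ T), Kˢ⟫ = c²·n!·⟪T, K⟫ ≠ 0` and `isotypicSum₁ (isotypicSum₂ T) ≠ 0`.
No definition is introduced (`Kˢ`, `c`, `K_X` are spelled out); sorry-free; nothing here proves `ω = 2` or closes an item.
[cite: BurgisserIkenmeyer2011, §3.1, §10.1, Thm. 5.13] [cite: FultonHarrisGTM129, Thm. 6.3, §15.5]
[cite: ChristandlVranaZuiddam2023, §3.1] [cite: SerreLinearRepresentations1977, §2.6 Thm. 8] [cite: Blaser2013, §6]
-/

noncomputable section

open scoped BigOperators Matrix Kronecker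

namespace Summit.MatrixMultiplication.MatrixMultiplication.Theorems.ObstructionDescentKernelUpper

open Literature.Computability.AlgebraicComplexity
open Literature.NumberTheory.DiophantineGeometry
open Literature.RepresentationTheory.GeneralLinear (isotypicProj_apply_of_mem_highestWeightSpace)
open Literature.RepresentationTheory.FiniteGroups (isotypicProj)
open Summit.MatrixMultiplication.MatrixMultiplication.Theorems.ObstructionDescentKernelPolarisation
open Summit.MatrixMultiplication.MatrixMultiplication.Theorems.ObstructionDescentBlowUpDuality
  (blowUp_det_eq_pairing_evalKernel letterIsotypic_eq_pairing_isotypicSum₃_evalKernel pairing_isotypicSum₃_comm)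
open Summit.MatrixMultiplication.MatrixMultiplication.Theorems.ObstructionCalculus
  (det_sum_kronecker_slice_actTensor₁₂ occurs_unitTensor_of_algBorderRank_le)

variable {N : ℕ}

/-! ### §4 On `(δ^N)`-highest-weight slices the rectangular character sum acts as the scalar `n!/χ(1)` -/

/-- If every leg-1 slice `u ↦ F(u,b,c)` lies in `HW_λ` (`λ` with at most `N` parts), then `isotypicSum₁ λ F = (n!/χ_λ(1)) • F`:
the word-model highest-weight space `HW_λ ≅ S^λ` is `χ_λ`-isotypic for the place-permutation action.
[cite: FultonHarrisGTM129, Thm. 6.3] [cite: SerreLinearRepresentations1977, §2.6 Thm. 8] -/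
theorem isotypicSum₁_eq_smul_of_slices_mem_highestWeightSpace {n : ℕ} {κ μ : Type*} (lam : Nat.Partition n)
    (hlam : lam.parts.card ≤ N) (F : Word N n → (Fin n → κ) → (Fin n → μ) → ℂ)
    (hF : ∀ b c, (fun u => F u b c) ∈ highestWeightSpace (wordRep ℂ N n) (Weight.ofPartition N lam)) :
    isotypicSum₁ lam F = ((Fintype.card (Equiv.Perm (Fin n)) : ℂ) / spechtCharacter ℂ lam 1) • F := by
  funext u b c
  have h := sum_spechtCharacter_smul_wordPerm_eq_isotypicProj lam (fun u => F u b c)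
  rw [map_smul, isotypicProj_apply_of_mem_highestWeightSpace lam hlam (hF b c)] at h
  have hu := congrFun h u
  simp only [Finset.sum_apply, Pi.smul_apply, wordPerm_apply, smul_eq_mul] at hu
  simp only [isotypicSum₁, Finset.sum_apply, Pi.smul_apply, permLegs₁_apply, smul_eq_mul]
  exact hu

/-- Leg-2 version: leg-2 slices in `HW_λ` force `isotypicSum₂ λ F = (n!/χ_λ(1)) • F`.
[cite: FultonHarrisGTM129, Thm. 6.3] [cite: SerreLinearRepresentations1977, §2.6 Thm. 8] -/
theorem isotypicSum₂_eq_smul_of_slices_mem_highestWeightSpace {n : ℕ} {ι μ : Type*} (lam : Nat.Partition n)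
    (hlam : lam.parts.card ≤ N) (F : (Fin n → ι) → Word N n → (Fin n → μ) → ℂ)
    (hF : ∀ a c, (fun v => F a v c) ∈ highestWeightSpace (wordRep ℂ N n) (Weight.ofPartition N lam)) :
    isotypicSum₂ lam F = ((Fintype.card (Equiv.Perm (Fin n)) : ℂ) / spechtCharacter ℂ lam 1) • F := by
  funext a v c
  have h := sum_spechtCharacter_smul_wordPerm_eq_isotypicProj lam (fun v => F a v c)
  rw [map_smul, isotypicProj_apply_of_mem_highestWeightSpace lam hlam (hF a c)] at h
  have hv := congrFun h v
  simp only [Finset.sum_apply, Pi.smul_apply, wordPerm_apply, smul_eq_mul] at hv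
  simp only [isotypicSum₂, Finset.sum_apply, Pi.smul_apply, permLegs₂_apply, smul_eq_mul]
  exact hv

/-! ### §5 Self-adjointness of the leg-1 and leg-2 character sums for the pairing -/

/-- `⟪isotypicSum₁ ν T, K⟫ = ⟪T, isotypicSum₁ ν K⟫` (`χ_ν(π⁻¹) = χ_ν(π)`, reindex `u ↦ u ∘ π`). [folklore] -/
theorem pairing_isotypicSum₁_comm {ι κ μ : Type*} [Fintype ι] [Fintype κ] [Fintype μ] [DecidableEq ι] {n : ℕ}
    (ν : Nat.Partition n) (T K : (Fin n → ι) → (Fin n → κ) → (Fin n → μ) → ℂ) :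
    ∑ u : Fin n → ι, ∑ v : Fin n → κ, ∑ w : Fin n → μ, isotypicSum₁ ν T u v w * K u v w =
      ∑ u : Fin n → ι, ∑ v : Fin n → κ, ∑ w : Fin n → μ, T u v w * isotypicSum₁ ν K u v w := by
  classical
  have hev : ∀ (F : (Fin n → ι) → (Fin n → κ) → (Fin n → μ) → ℂ) (u : Fin n → ι) (v : Fin n → κ)
      (w : Fin n → μ), isotypicSum₁ ν F u v w = ∑ π : Equiv.Perm (Fin n), spechtCharacter ℂ ν π * F (u ∘ ⇑π) v w := by
    intro F u v w
    simp only [isotypicSum₁, Finset.sum_apply, Pi.smul_apply, permLegs₁_apply, smul_eq_mul]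
  simp_rw [hev, Finset.sum_mul, Finset.mul_sum]
  refine ((sum_comm₁₄ _).trans ?_).trans (sum_comm₁₄ _).symm
  rw [← Equiv.sum_comp (Equiv.inv (Equiv.Perm (Fin n)))]
  refine Finset.sum_congr rfl fun π _ => ?_
  simp only [Equiv.inv_apply, spechtCharacter_inv]
  refine Finset.sum_congr rfl fun v _ => Finset.sum_congr rfl fun w _ => ?_
  refine Fintype.sum_equiv (Equiv.arrowCongr π (Equiv.refl ι)) _ _ fun u => ?_
  have h1 : (Equiv.arrowCongr π (Equiv.refl ι)) u = u ∘ ⇑π⁻¹ := by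
    funext k; simp [Equiv.arrowCongr_apply, Equiv.Perm.inv_def]
  have h2 : (u ∘ ⇑π⁻¹) ∘ ⇑π = u := by
    funext k; simp
  rw [h1, h2]
  ring

/-- `⟪isotypicSum₂ ν T, K⟫ = ⟪T, isotypicSum₂ ν K⟫`. [folklore] -/
theorem pairing_isotypicSum₂_comm {ι κ μ : Type*} [Fintype ι] [Fintype κ] [Fintype μ] [DecidableEq κ] {n : ℕ}
    (ν : Nat.Partition n) (T K : (Fin n → ι) → (Fin n → κ) → (Fin n → μ) → ℂ) :
    ∑ u : Fin n → ι, ∑ v : Fin n → κ, ∑ w : Fin n → μ, isotypicSum₂ ν T u v w * K u v w =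
      ∑ u : Fin n → ι, ∑ v : Fin n → κ, ∑ w : Fin n → μ, T u v w * isotypicSum₂ ν K u v w := by
  classical
  have hev : ∀ (F : (Fin n → ι) → (Fin n → κ) → (Fin n → μ) → ℂ) (u : Fin n → ι) (v : Fin n → κ)
      (w : Fin n → μ), isotypicSum₂ ν F u v w = ∑ π : Equiv.Perm (Fin n), spechtCharacter ℂ ν π * F u (v ∘ ⇑π) w := by
    intro F u v w
    simp only [isotypicSum₂, Finset.sum_apply, Pi.smul_apply, permLegs₂_apply, smul_eq_mul]
  simp_rw [hev, Finset.sum_mul, Finset.mul_sum]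
  refine Finset.sum_congr rfl fun u _ => ?_
  refine ((sum_comm₁₃ _).trans ?_).trans (sum_comm₁₃ _).symm
  rw [← Equiv.sum_comp (Equiv.inv (Equiv.Perm (Fin n)))]
  refine Finset.sum_congr rfl fun π _ => ?_
  simp only [Equiv.inv_apply, spechtCharacter_inv]
  refine Finset.sum_congr rfl fun w _ => ?_
  refine Fintype.sum_equiv (Equiv.arrowCongr π (Equiv.refl κ)) _ _ fun v => ?_
  have h1 : (Equiv.arrowCongr π (Equiv.refl κ)) v = v ∘ ⇑π⁻¹ := by
    funext k; simp [Equiv.arrowCongr_apply, Equiv.Perm.inv_def]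
  have h2 : (v ∘ ⇑π⁻¹) ∘ ⇑π = v := by
    funext k; simp
  rw [h1, h2]
  ring

/-! ### §6 Diagonal symmetry of `isotypicSum₃ ν (t^{⊗n})` and the symmetrised pairing -/

/-- `isotypicSum₃ ν (t^{⊗n})` is invariant under the simultaneous permutation of all three words (`χ_ν` is a class
function). [folklore] -/
theorem isotypicSum₃_kroneckerPow_comp_perm {n : ℕ} (ν : Nat.Partition n) (t : Fin N → Fin N → Fin N → ℂ)
    (ρ : Equiv.Perm (Fin n)) (u v w : Word N n) :
    isotypicSum₃ ν (kroneckerPow t n) (u ∘ ⇑ρ) (v ∘ ⇑ρ) (w ∘ ⇑ρ) = isotypicSum₃ ν (kroneckerPow t n) u v w := by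
  classical
  simp only [isotypicSum₃, Finset.sum_apply, Pi.smul_apply, permLegs₃_apply, smul_eq_mul]
  -- reindex `π ↦ ρ π ρ⁻¹`
  refine Fintype.sum_equiv (MulAut.conj ρ).toEquiv _ _ fun π => ?_
  have hπ : (MulAut.conj ρ).toEquiv π = ρ * π * ρ⁻¹ := rfl
  rw [hπ]
  have hχ : spechtCharacter ℂ ν (ρ * π * ρ⁻¹) = spechtCharacter ℂ ν π := spechtCharacter_conj ℂ ν π ρ
  rw [hχ, kroneckerPow_apply, kroneckerPow_apply, ← Equiv.prod_comp ρ (fun k => t (u k) (v k) ((w ∘ ⇑(ρ * π * ρ⁻¹)) k))]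
  congr 1
  refine Finset.prod_congr rfl fun k _ => ?_
  simp [Function.comp_apply, Equiv.Perm.inv_def]

/-- The pairing of a diagonally symmetric `T` with the symmetrisation of `K` is `n!` times `⟪T, K⟫`. [folklore] -/
theorem pairing_sum_perm_eq_card_mul {n : ℕ} (T K : Word N n → Word N n → Word N n → ℂ)
    (hT : ∀ (ρ : Equiv.Perm (Fin n)) (u v w : Word N n), T (u ∘ ⇑ρ) (v ∘ ⇑ρ) (w ∘ ⇑ρ) = T u v w) :
    ∑ u : Word N n, ∑ v : Word N n, ∑ w : Word N n,
        T u v w * ∑ ρ : Equiv.Perm (Fin n), K (u ∘ ⇑ρ) (v ∘ ⇑ρ) (w ∘ ⇑ρ) =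
      (Fintype.card (Equiv.Perm (Fin n)) : ℂ) *
        ∑ u : Word N n, ∑ v : Word N n, ∑ w : Word N n, T u v w * K u v w := by
  classical
  have hρ : ∀ ρ : Equiv.Perm (Fin n), ∑ u : Word N n, ∑ v : Word N n, ∑ w : Word N n,
      T u v w * K (u ∘ ⇑ρ) (v ∘ ⇑ρ) (w ∘ ⇑ρ) = ∑ u : Word N n, ∑ v : Word N n, ∑ w : Word N n, T u v w * K u v w := by
    intro ρ
    have he : ∀ x : Word N n, (Equiv.arrowCongr ρ (Equiv.refl (Fin N))) x = x ∘ ⇑ρ⁻¹ := by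
      intro x; funext k; simp [Equiv.arrowCongr_apply, Equiv.Perm.inv_def]
    have hc : ∀ x : Word N n, (x ∘ ⇑ρ⁻¹) ∘ ⇑ρ = x := by
      intro x; funext k; simp
    symm
    refine Fintype.sum_equiv (Equiv.arrowCongr ρ (Equiv.refl (Fin N))) _ _ fun u => ?_
    refine Fintype.sum_equiv (Equiv.arrowCongr ρ (Equiv.refl (Fin N))) _ _ fun v => ?_
    refine Fintype.sum_equiv (Equiv.arrowCongr ρ (Equiv.refl (Fin N))) _ _ fun w => ?_
    rw [he, he, he, hc, hc, hc, hT]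
  conv_lhs => simp only [Finset.mul_sum]
  have h1 : ∀ u v, ∑ w : Word N n, ∑ ρ : Equiv.Perm (Fin n), T u v w * K (u ∘ ⇑ρ) (v ∘ ⇑ρ) (w ∘ ⇑ρ) =
      ∑ ρ : Equiv.Perm (Fin n), ∑ w : Word N n, T u v w * K (u ∘ ⇑ρ) (v ∘ ⇑ρ) (w ∘ ⇑ρ) := fun u v => Finset.sum_comm
  have h2 : ∀ u, ∑ v : Word N n, ∑ ρ : Equiv.Perm (Fin n), ∑ w : Word N n, T u v w * K (u ∘ ⇑ρ) (v ∘ ⇑ρ) (w ∘ ⇑ρ) =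
      ∑ ρ : Equiv.Perm (Fin n), ∑ v : Word N n, ∑ w : Word N n, T u v w * K (u ∘ ⇑ρ) (v ∘ ⇑ρ) (w ∘ ⇑ρ) :=
    fun u => Finset.sum_comm
  have h3 : ∑ u : Word N n, ∑ ρ : Equiv.Perm (Fin n), ∑ v : Word N n, ∑ w : Word N n,
      T u v w * K (u ∘ ⇑ρ) (v ∘ ⇑ρ) (w ∘ ⇑ρ) =
      ∑ ρ : Equiv.Perm (Fin n), ∑ u : Word N n, ∑ v : Word N n, ∑ w : Word N n, T u v w * K (u ∘ ⇑ρ) (v ∘ ⇑ρ) (w ∘ ⇑ρ) :=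
    Finset.sum_comm
  simp_rw [h1, h2]
  rw [h3]
  simp_rw [hρ]
  rw [Finset.sum_const, Finset.card_univ, nsmul_eq_mul]

/-! ### §7 The upper direction -/

/-- **Upper direction of the blow-up duality (kernel form).**  `n = Nδ`; `K` any kernel whose functional
`t ↦ ⟪t^{⊗n}, K⟫` is a `det^δ`-semi-invariant in legs 1 and 2.  Then `⟪isotypicSum₃ ν (t^{⊗n}), K⟫ ≠ 0` forces the
OCCURRENCE of `((δ^N),(δ^N),ν)` in `t^{⊗n}`.  [this node; cite: BurgisserIkenmeyer2011, §3.1, §10.1] -/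
theorem isotypicSum₁₂₃_kroneckerPow_ne_zero_of_pairing_isotypicSum₃_ne_zero {δ : ℕ}
    (K : Word N (N * δ) → Word N (N * δ) → Word N (N * δ) → ℂ)
    (hK₁ : ∀ (A : Matrix (Fin N) (Fin N) ℂ) (t : Fin N → Fin N → Fin N → ℂ),
      ∑ u : Word N (N * δ), ∑ v : Word N (N * δ), ∑ w : Word N (N * δ),
          kroneckerPow (actTensor A (1 : Matrix (Fin N) (Fin N) ℂ) (1 : Matrix (Fin N) (Fin N) ℂ) t) (N * δ) u v w *
            K u v w =
        A.det ^ δ * ∑ u : Word N (N * δ), ∑ v : Word N (N * δ), ∑ w : Word N (N * δ),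
          kroneckerPow t (N * δ) u v w * K u v w)
    (hK₂ : ∀ (B : Matrix (Fin N) (Fin N) ℂ) (t : Fin N → Fin N → Fin N → ℂ),
      ∑ u : Word N (N * δ), ∑ v : Word N (N * δ), ∑ w : Word N (N * δ),
          kroneckerPow (actTensor (1 : Matrix (Fin N) (Fin N) ℂ) B (1 : Matrix (Fin N) (Fin N) ℂ) t) (N * δ) u v w *
            K u v w =
        B.det ^ δ * ∑ u : Word N (N * δ), ∑ v : Word N (N * δ), ∑ w : Word N (N * δ),
          kroneckerPow t (N * δ) u v w * K u v w)
    (ν : Nat.Partition (N * δ)) (t : Fin N → Fin N → Fin N → ℂ)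
    (h : ∑ u : Word N (N * δ), ∑ v : Word N (N * δ), ∑ w : Word N (N * δ),
      isotypicSum₃ ν (kroneckerPow t (N * δ)) u v w * K u v w ≠ 0) :
    isotypicSum₁ (Nat.Partition.rectangle N δ) (isotypicSum₂ (Nat.Partition.rectangle N δ)
      (isotypicSum₃ ν (kroneckerPow t (N * δ)))) ≠ 0 := by
  classical
  intro hO
  apply h
  -- the scalar `c = n!/χ(1)` and the symmetrised kernel
  have hc : ((Fintype.card (Equiv.Perm (Fin (N * δ))) : ℂ) / spechtCharacter ℂ (Nat.Partition.rectangle N δ) 1) ≠ 0 :=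
    div_ne_zero (Nat.cast_ne_zero.mpr Fintype.card_ne_zero) (spechtCharacter_one_ne_zero _)
  have h1 := isotypicSum₁_eq_smul_of_slices_mem_highestWeightSpace (Nat.Partition.rectangle N δ)
    (Nat.Partition.card_parts_rectangle_le N δ)
    (fun u v w => ∑ ρ : Equiv.Perm (Fin (N * δ)), K (u ∘ ⇑ρ) (v ∘ ⇑ρ) (w ∘ ⇑ρ))
    (fun v w => mem_highestWeightSpace_rectangle_of_equivariant _ fun A u => symm_leg₁_eq_det_pow_mul K hK₁ A u v w)
  have h2 := isotypicSum₂_eq_smul_of_slices_mem_highestWeightSpace (Nat.Partition.rectangle N δ)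
    (Nat.Partition.card_parts_rectangle_le N δ)
    (fun u v w => ∑ ρ : Equiv.Perm (Fin (N * δ)), K (u ∘ ⇑ρ) (v ∘ ⇑ρ) (w ∘ ⇑ρ))
    (fun u w => mem_highestWeightSpace_rectangle_of_equivariant _ fun B v => symm_leg₂_eq_det_pow_mul K hK₂ B u v w)
  -- `⟪iso₁ iso₂ T, Kˢ⟫ = c² · n! · ⟪T, K⟫`
  have hchain : ∑ u : Word N (N * δ), ∑ v : Word N (N * δ), ∑ w : Word N (N * δ),
      isotypicSum₁ (Nat.Partition.rectangle N δ) (isotypicSum₂ (Nat.Partition.rectangle N δ)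
        (isotypicSum₃ ν (kroneckerPow t (N * δ)))) u v w *
          ∑ ρ : Equiv.Perm (Fin (N * δ)), K (u ∘ ⇑ρ) (v ∘ ⇑ρ) (w ∘ ⇑ρ) =
      ((Fintype.card (Equiv.Perm (Fin (N * δ))) : ℂ) / spechtCharacter ℂ (Nat.Partition.rectangle N δ) 1) *
        (((Fintype.card (Equiv.Perm (Fin (N * δ))) : ℂ) / spechtCharacter ℂ (Nat.Partition.rectangle N δ) 1) *
          ((Fintype.card (Equiv.Perm (Fin (N * δ))) : ℂ) * ∑ u : Word N (N * δ), ∑ v : Word N (N * δ),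
            ∑ w : Word N (N * δ), isotypicSum₃ ν (kroneckerPow t (N * δ)) u v w * K u v w)) := by
    rw [pairing_isotypicSum₁_comm, h1]
    simp only [Pi.smul_apply, smul_eq_mul]
    simp_rw [← mul_assoc, mul_comm _ (((Fintype.card (Equiv.Perm (Fin (N * δ))) : ℂ) /
      spechtCharacter ℂ (Nat.Partition.rectangle N δ) 1)), mul_assoc, ← Finset.mul_sum]
    congr 1
    rw [pairing_isotypicSum₂_comm, h2]
    simp only [Pi.smul_apply, smul_eq_mul]
    simp_rw [← mul_assoc, mul_comm _ (((Fintype.card (Equiv.Perm (Fin (N * δ))) : ℂ) /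
      spechtCharacter ℂ (Nat.Partition.rectangle N δ) 1)), mul_assoc, ← Finset.mul_sum]
    congr 1
    exact pairing_sum_perm_eq_card_mul _ K (isotypicSum₃_kroneckerPow_comp_perm ν t)
  rw [hO] at hchain
  simp only [Pi.zero_apply, zero_mul, Finset.sum_const_zero] at hchain
  have := hchain.symm
  simp only [mul_eq_zero, hc, Nat.cast_eq_zero, Fintype.card_ne_zero, false_or] at this
  exact this

/-! ### §8 The blow-up kernel `K_X`: semi-invariance, the upper direction of (T), inheritance to `⟨m⟩` -/

section BlowUp

variable {δ : ℕ}

/-- Leg-1 semi-invariance of the blow-up functional `t ↦ D_X(t) = ⟪t^{⊗Nδ}, K_X⟫`, in kernel form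
(K25 `det_sum_kronecker_slice_actTensor₁₂` + `blowUp_det_eq_pairing_evalKernel`). [this node] -/
theorem pairing_blowUpKernel_actTensor₁ (e : Fin (N * δ) ≃ Fin δ × Fin N) (X : Fin N → Matrix (Fin δ) (Fin δ) ℂ)
    (A : Matrix (Fin N) (Fin N) ℂ) (t : Fin N → Fin N → Fin N → ℂ) :
    ∑ u : Word N (N * δ), ∑ v : Word N (N * δ), ∑ w : Word N (N * δ),
        kroneckerPow (actTensor A (1 : Matrix (Fin N) (Fin N) ℂ) (1 : Matrix (Fin N) (Fin N) ℂ) t) (N * δ) u v w *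
          ∑ σ : Equiv.Perm (Fin δ × Fin N),
            (if (fun k => (σ (e k)).2) = u ∧ (fun k => (e k).2) = v then
              ((Equiv.Perm.sign σ : ℤ) : ℂ) *
                kroneckerPow (fun l a b => X l a b) (N * δ) w (fun k => (σ (e k)).1) (fun k => (e k).1)
            else 0) =
      A.det ^ δ * ∑ u : Word N (N * δ), ∑ v : Word N (N * δ), ∑ w : Word N (N * δ),
        kroneckerPow t (N * δ) u v w *
          ∑ σ : Equiv.Perm (Fin δ × Fin N),
            (if (fun k => (σ (e k)).2) = u ∧ (fun k => (e k).2) = v then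
              ((Equiv.Perm.sign σ : ℤ) : ℂ) *
                kroneckerPow (fun l a b => X l a b) (N * δ) w (fun k => (σ (e k)).1) (fun k => (e k).1)
            else 0) := by
  rw [← blowUp_det_eq_pairing_evalKernel e X (actTensor A (1 : Matrix (Fin N) (Fin N) ℂ) (1 : Matrix (Fin N) (Fin N) ℂ) t),
    ← blowUp_det_eq_pairing_evalKernel e X t, det_sum_kronecker_slice_actTensor₁₂ X A 1 t]
  simp [Matrix.det_one]

/-- Leg-2 semi-invariance of the blow-up functional, in kernel form. [this node] -/
theorem pairing_blowUpKernel_actTensor₂ (e : Fin (N * δ) ≃ Fin δ × Fin N) (X : Fin N → Matrix (Fin δ) (Fin δ) ℂ)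
    (B : Matrix (Fin N) (Fin N) ℂ) (t : Fin N → Fin N → Fin N → ℂ) :
    ∑ u : Word N (N * δ), ∑ v : Word N (N * δ), ∑ w : Word N (N * δ),
        kroneckerPow (actTensor (1 : Matrix (Fin N) (Fin N) ℂ) B (1 : Matrix (Fin N) (Fin N) ℂ) t) (N * δ) u v w *
          ∑ σ : Equiv.Perm (Fin δ × Fin N),
            (if (fun k => (σ (e k)).2) = u ∧ (fun k => (e k).2) = v then
              ((Equiv.Perm.sign σ : ℤ) : ℂ) *
                kroneckerPow (fun l a b => X l a b) (N * δ) w (fun k => (σ (e k)).1) (fun k => (e k).1)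
            else 0) =
      B.det ^ δ * ∑ u : Word N (N * δ), ∑ v : Word N (N * δ), ∑ w : Word N (N * δ),
        kroneckerPow t (N * δ) u v w *
          ∑ σ : Equiv.Perm (Fin δ × Fin N),
            (if (fun k => (σ (e k)).2) = u ∧ (fun k => (e k).2) = v then
              ((Equiv.Perm.sign σ : ℤ) : ℂ) *
                kroneckerPow (fun l a b => X l a b) (N * δ) w (fun k => (σ (e k)).1) (fun k => (e k).1)
            else 0) := by
  rw [← blowUp_det_eq_pairing_evalKernel e X (actTensor (1 : Matrix (Fin N) (Fin N) ℂ) B (1 : Matrix (Fin N) (Fin N) ℂ) t),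
    ← blowUp_det_eq_pairing_evalKernel e X t, det_sum_kronecker_slice_actTensor₁₂ X 1 B t]
  simp [Matrix.det_one]

/-- **Upper direction of the blow-up duality (T).**  If the letter-`ν` part of the blow-up determinant `D_X(t) =
det(Σ_l X_l ⊗ t_{••l})` — the `ν`-isotypic sum over the `Nδ` letters of `X`, paired with `t^{⊗Nδ}` — is non-zero, then
`((δ^N),(δ^N),ν) ∈ S(t)`: the triple occurs in `t^{⊗Nδ}`.  (Lower direction = the two-rectangle floor law.)
[this node; cite: BurgisserIkenmeyer2011, §3.1, Thm. 5.13] -/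
theorem occurs_twoRectangle_of_letterIsotypic_ne_zero (e : Fin (N * δ) ≃ Fin δ × Fin N) (ν : Nat.Partition (N * δ))
    (X : Fin N → Matrix (Fin δ) (Fin δ) ℂ) (t : Fin N → Fin N → Fin N → ℂ)
    (h : (∑ σ : Equiv.Perm (Fin δ × Fin N), ((Equiv.Perm.sign σ : ℤ) : ℂ) *
        ∑ w : Fin (N * δ) → Fin N,
          isotypicSum₁ ν (kroneckerPow (fun l a b => X l a b) (N * δ)) w (fun k => (σ (e k)).1) (fun k => (e k).1) *
            kroneckerPow t (N * δ) (fun k => (σ (e k)).2) (fun k => (e k).2) w) ≠ 0) :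
    isotypicSum₁ (Nat.Partition.rectangle N δ) (isotypicSum₂ (Nat.Partition.rectangle N δ)
      (isotypicSum₃ ν (kroneckerPow t (N * δ)))) ≠ 0 := by
  classical
  rw [letterIsotypic_eq_pairing_isotypicSum₃_evalKernel e ν X t, ← pairing_isotypicSum₃_comm] at h
  exact isotypicSum₁₂₃_kroneckerPow_ne_zero_of_pairing_isotypicSum₃_ne_zero _
    (fun A t' => pairing_blowUpKernel_actTensor₁ e X A t') (fun B t' => pairing_blowUpKernel_actTensor₂ e X B t') ν t h

/-- **Inheritance to the unit tensor.**  Under the hypothesis of `occurs_twoRectangle_of_letterIsotypic_ne_zero`, the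
triple `((δ^N),(δ^N),ν)` occurs in `⟨m⟩^{⊗Nδ}` for every format `m ≥ N` with `bR(t) ≤ m` (`S(t) ⊆ S(⟨m⟩)` along the
degeneration, `occurs_unitTensor_of_algBorderRank_le`). [this node; cite: BurgisserIkenmeyer2011, Lemma 10.18] -/
theorem occurs_unitTensor_twoRectangle_of_letterIsotypic_ne_zero {m : ℕ} (hNm : N ≤ m)
    (e : Fin (N * δ) ≃ Fin δ × Fin N) (ν : Nat.Partition (N * δ)) (X : Fin N → Matrix (Fin δ) (Fin δ) ℂ)
    (t : Fin N → Fin N → Fin N → ℂ) (hbr : algBorderRank t ≤ m)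
    (h : (∑ σ : Equiv.Perm (Fin δ × Fin N), ((Equiv.Perm.sign σ : ℤ) : ℂ) *
        ∑ w : Fin (N * δ) → Fin N,
          isotypicSum₁ ν (kroneckerPow (fun l a b => X l a b) (N * δ)) w (fun k => (σ (e k)).1) (fun k => (e k).1) *
            kroneckerPow t (N * δ) (fun k => (σ (e k)).2) (fun k => (e k).2) w) ≠ 0) :
    isotypicSum₁ (Nat.Partition.rectangle N δ) (isotypicSum₂ (Nat.Partition.rectangle N δ)
      (isotypicSum₃ ν (kroneckerPow (unitTensor ℂ m) (N * δ)))) ≠ 0 := by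
  have hocc := occurs_twoRectangle_of_letterIsotypic_ne_zero e ν X t h
  have := occurs_unitTensor_of_algBorderRank_le hNm t hbr (N * δ)
    ![Nat.Partition.rectangle N δ, Nat.Partition.rectangle N δ, ν] (by simpa using hocc)
  simpa using this

end BlowUp

end Summit.MatrixMultiplication.MatrixMultiplication.Theorems.ObstructionDescentKernelUpper
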